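import Mathlib

/-!
# `DivisionGap.PerMultiplesHard` (stmt-ValiantsHypothesis-5068), line `uncharged-face-walk`:
block completion (stub `stub_blockCompletion`)

Pure table bookkeeping for the block-slice descent.  A *table* is an exponent
`M : (Fin n × Fin n) →₀ ℕ` (cells `(row, col)`), `G` is the host cell set, `A` the rows and `B`
the columns of a block, both of size `a`, enumerated by `eA : Fin a ≃ A` and `eB : Fin a ≃ B`.
Given a `G`-supported table `M₀` and a new block content `m'` on `Fin a × Fin a` (its cells landing
in `G`, with the same block row sums and block column sums as the block of `M₀`), the table
`M :=` "`M₀` with its `A × B` block replaced by `m'`" is supported in `G`, has the row and column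
sums of `M₀`, carries the same mass on the block-diagonal cells `{e | e.1 ∈ A ↔ e.2 ∈ B}`
(`= A × B ∪ Aᶜ × Bᶜ`), and restricts to `m'` on the block.

The three accounting lemmas `row_sums_of_block`, `col_sums_of_block`, `degree_filter_of_block`
are stated abstractly: they only use that `M` and `M₀` agree off the block and have equal block
row (resp. column) sums.
-/

noncomputable section

set_option linter.dupNamespace false

namespace Summit.ValiantsHypothesis.ValiantsHypothesis.Theorems.DivisionGap.PerMultiplesHard.BlockCompletion

open scoped BigOperators

open Finset

/-- Row sums are unchanged when a table is modified only inside the block `A × B` and, for every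
row of `A`, the block row sum over `B` is preserved. [folklore] -/
theorem row_sums_of_block {n : ℕ} (A B : Finset (Fin n)) (M M₀ : (Fin n × Fin n) →₀ ℕ)
    (hoff : ∀ i j, ¬ (i ∈ A ∧ j ∈ B) → M (i, j) = M₀ (i, j))
    (hrow : ∀ i ∈ A, ∑ j ∈ B, M (i, j) = ∑ j ∈ B, M₀ (i, j)) (i : Fin n) :
    ∑ j, M (i, j) = ∑ j, M₀ (i, j) := by
  by_cases hi : i ∈ A
  · rw [← sum_add_sum_compl B fun j => M (i, j), ← sum_add_sum_compl B fun j => M₀ (i, j),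
      hrow i hi]
    congr 1
    refine sum_congr rfl fun j hj => ?_
    rw [mem_compl] at hj
    exact hoff i j fun h => hj h.2
  · exact sum_congr rfl fun j _ => hoff i j fun h => hi h.1

/-- Column sums are unchanged when a table is modified only inside the block `A × B` and, for
every column of `B`, the block column sum over `A` is preserved. [folklore] -/
theorem col_sums_of_block {n : ℕ} (A B : Finset (Fin n)) (M M₀ : (Fin n × Fin n) →₀ ℕ)
    (hoff : ∀ i j, ¬ (i ∈ A ∧ j ∈ B) → M (i, j) = M₀ (i, j))
    (hcol : ∀ j ∈ B, ∑ i ∈ A, M (i, j) = ∑ i ∈ A, M₀ (i, j)) (j : Fin n) :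
    ∑ i, M (i, j) = ∑ i, M₀ (i, j) := by
  by_cases hj : j ∈ B
  · rw [← sum_add_sum_compl A fun i => M (i, j), ← sum_add_sum_compl A fun i => M₀ (i, j),
      hcol j hj]
    congr 1
    refine sum_congr rfl fun i hi => ?_
    rw [mem_compl] at hi
    exact hoff i j fun h => hi h.1
  · exact sum_congr rfl fun i _ => hoff i j fun h => hj h.2

/-- The mass of a table on the block-diagonal cells `{e | e.1 ∈ A ↔ e.2 ∈ B}`, written as an
iterated sum over rows and then columns. [folklore] -/
theorem degree_filter_blockDiag_eq_sum {n : ℕ} (A B : Finset (Fin n))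
    (N : (Fin n × Fin n) →₀ ℕ) :
    (N.filter (fun e : Fin n × Fin n => (e.1 ∈ A ↔ e.2 ∈ B))).degree =
      ∑ i, ∑ j, if (i ∈ A ↔ j ∈ B) then N (i, j) else 0 := by
  rw [Finsupp.degree_eq_sum, Fintype.sum_prod_type]
  simp only [Finsupp.filter_apply]

/-- The block-diagonal mass (on the cells `{e | e.1 ∈ A ↔ e.2 ∈ B} = A × B ∪ Aᶜ × Bᶜ`) is
unchanged when a table is modified only inside the block `A × B` and, for every row of `A`, the
block row sum over `B` is preserved. [folklore] -/
theorem degree_filter_of_block {n : ℕ} (A B : Finset (Fin n)) (M M₀ : (Fin n × Fin n) →₀ ℕ)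
    (hoff : ∀ i j, ¬ (i ∈ A ∧ j ∈ B) → M (i, j) = M₀ (i, j))
    (hrow : ∀ i ∈ A, ∑ j ∈ B, M (i, j) = ∑ j ∈ B, M₀ (i, j)) :
    (M.filter (fun e : Fin n × Fin n => (e.1 ∈ A ↔ e.2 ∈ B))).degree =
      (M₀.filter (fun e : Fin n × Fin n => (e.1 ∈ A ↔ e.2 ∈ B))).degree := by
  rw [degree_filter_blockDiag_eq_sum, degree_filter_blockDiag_eq_sum]
  refine sum_congr rfl fun i _ => ?_
  by_cases hi : i ∈ A
  · -- row of `A`: the block-diagonal cells of this row are exactly the columns of `B`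
    have key : ∀ N : (Fin n × Fin n) →₀ ℕ,
        (∑ j, if (i ∈ A ↔ j ∈ B) then N (i, j) else 0) = ∑ j ∈ B, N (i, j) := by
      intro N
      simp only [hi, true_iff, sum_ite_mem_eq]
    rw [key M, key M₀, hrow i hi]
  · -- row off `A`: the table is unchanged on the whole row
    exact sum_congr rfl fun j _ => by rw [hoff i j fun h => hi h.1]

/-- **Block completion.**  For a `G`-supported table `M₀ : (Fin n × Fin n) →₀ ℕ`, a block
`A × B` with `A`, `B` enumerated by `eA : Fin a ≃ A`, `eB : Fin a ≃ B`, and a new block content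
`m' : (Fin a × Fin a) →₀ ℕ` whose cells land in `G` and whose row and column sums agree with those
of the block of `M₀`, the table "`M₀` with its `A × B` block replaced by `m'`" is supported in `G`,
has the row sums and column sums of `M₀`, the same mass on the block-diagonal cells
`{e | e.1 ∈ A ↔ e.2 ∈ B}`, and restricts to `m'` on the block. [folklore] -/
theorem stub_blockCompletion :
    ∀ (n a : ℕ) (G : Finset (Fin n × Fin n)) (A B : Finset (Fin n)) (eA : Fin a ≃ {x // x ∈ A}) (eB : Fin a ≃ {x // x ∈ B})
      (M₀ : (Fin n × Fin n) →₀ ℕ) (m' : (Fin a × Fin a) →₀ ℕ),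
      M₀.support ⊆ G →
      (∀ e ∈ m'.support, ((eA e.1 : Fin n), (eB e.2 : Fin n)) ∈ G) →
      (∀ x : Fin a, ∑ y, m' (x, y) = ∑ y, M₀ ((eA x : Fin n), (eB y : Fin n))) →
      (∀ y : Fin a, ∑ x, m' (x, y) = ∑ x, M₀ ((eA x : Fin n), (eB y : Fin n))) →
      ∃ M : (Fin n × Fin n) →₀ ℕ, M.support ⊆ G ∧
        (∀ i, ∑ j, M (i, j) = ∑ j, M₀ (i, j)) ∧ (∀ j, ∑ i, M (i, j) = ∑ i, M₀ (i, j)) ∧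
        (M.filter (fun e : Fin n × Fin n => (e.1 ∈ A ↔ e.2 ∈ B))).degree =
          (M₀.filter (fun e : Fin n × Fin n => (e.1 ∈ A ↔ e.2 ∈ B))).degree ∧
        ∀ x y : Fin a, M ((eA x : Fin n), (eB y : Fin n)) = m' (x, y) := by
  intro n a G A B eA eB M₀ m' hG hG' hr hc
  /- The completed table: `m'` (transported along `eA × eB`) on the block `A × B`,
  `M₀` everywhere else. -/
  set M : (Fin n × Fin n) →₀ ℕ := Finsupp.equivFunOnFinite.symm fun e =>
    if h : e.1 ∈ A ∧ e.2 ∈ B then m' (eA.symm ⟨e.1, h.1⟩, eB.symm ⟨e.2, h.2⟩) else M₀ e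
  have hMe : ∀ i j : Fin n, M (i, j) =
      if h : i ∈ A ∧ j ∈ B then m' (eA.symm ⟨i, h.1⟩, eB.symm ⟨j, h.2⟩) else M₀ (i, j) :=
    fun i j => rfl
  -- values on the block and off the block
  have hon : ∀ (i j : Fin n) (hi : i ∈ A) (hj : j ∈ B),
      M (i, j) = m' (eA.symm ⟨i, hi⟩, eB.symm ⟨j, hj⟩) := by
    intro i j hi hj
    rw [hMe, dif_pos (And.intro hi hj)]
  have hoff : ∀ i j, ¬ (i ∈ A ∧ j ∈ B) → M (i, j) = M₀ (i, j) := by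
    intro i j h
    rw [hMe, dif_neg h]
  -- restriction to the block
  have hres : ∀ x y : Fin a, M ((eA x : Fin n), (eB y : Fin n)) = m' (x, y) := by
    intro x y
    rw [hon _ _ (eA x).2 (eB y).2]
    simp only [Subtype.coe_eta, Equiv.symm_apply_apply]
  -- support inside `G`
  have hsupp : M.support ⊆ G := by
    rintro ⟨i, j⟩ he
    rw [Finsupp.mem_support_iff] at he
    by_cases h : i ∈ A ∧ j ∈ B
    · rw [hon i j h.1 h.2] at he
      simpa using hG' _ (Finsupp.mem_support_iff.2 he)
    · rw [hoff i j h] at he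
      exact hG (Finsupp.mem_support_iff.2 he)
  -- block row sums: row `i = eA x` of the block sums to `∑ y, m' (x, y) = ∑ y, M₀ (eA x, eB y)`
  have hrow : ∀ i ∈ A, ∑ j ∈ B, M (i, j) = ∑ j ∈ B, M₀ (i, j) := by
    intro i hi
    have reind : ∀ g : Fin n → ℕ, ∑ j ∈ B, g j = ∑ y : Fin a, g (eB y : Fin n) := fun g => by
      rw [← sum_coe_sort B g, ← Equiv.sum_comp eB fun z : {x // x ∈ B} => g (z : Fin n)]
    rw [reind, reind]
    obtain ⟨x, rfl⟩ : ∃ x : Fin a, (eA x : Fin n) = i := ⟨eA.symm ⟨i, hi⟩, by simp⟩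
    simp only [hres]
    exact hr x
  -- block column sums, symmetrically
  have hcol : ∀ j ∈ B, ∑ i ∈ A, M (i, j) = ∑ i ∈ A, M₀ (i, j) := by
    intro j hj
    have reind : ∀ g : Fin n → ℕ, ∑ i ∈ A, g i = ∑ x : Fin a, g (eA x : Fin n) := fun g => by
      rw [← sum_coe_sort A g, ← Equiv.sum_comp eA fun z : {x // x ∈ A} => g (z : Fin n)]
    rw [reind, reind]
    obtain ⟨y, rfl⟩ : ∃ y : Fin a, (eB y : Fin n) = j := ⟨eB.symm ⟨j, hj⟩, by simp⟩
    simp only [hres]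
    exact hc y
  exact ⟨M, hsupp, row_sums_of_block A B M M₀ hoff hrow, col_sums_of_block A B M M₀ hoff hcol,
    degree_filter_of_block A B M M₀ hoff hrow, hres⟩

end Summit.ValiantsHypothesis.ValiantsHypothesis.Theorems.DivisionGap.PerMultiplesHard.BlockCompletion
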